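import Summits.QuantumFields.YangMills.Theorems.UnitScaleTiltProp7Lane2FamilyRows
import HarnessLib

/-!
# Route `UnitScaleTilt`, crux «MinimiserStabilityRegPr» (stmt-QuantumFields-19200), E′ ∕ (N06) LANE II «DIVERGENCE RECOVERY AT CURVED `W`» — (FAM) FILE 2:
# THE SEVEN FAMILY ROWS IN `hPatch`'s EXACT SHAPE `… ≤ ν * ∑ i, X i` WITH FREE PER-PATCH LETTERS `X` AND ONE `ν ≥ 392`

Cell `ym3-torus`, width seat `ym3-torus-px12` (gen 9); ★p1 g19 12:26:11Z «(FAM) WANTED — state it over `i : Site (F.P K) 0` with `Z i := Zs i`, `ZE i := Zb i` and the per-i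
letters FREE, ν := the max of the absolute constants»; px11 g7 12:26:19Z «GO — keep the seven conclusions in `hPatch`'s EXACT shape».  Explicit-unit helper,
`--supports stmt-QuantumFields-19200`, count-neutral.  YM₃ on T³ is a ladder rung (R3) — NOT d = 4, NOT infinite volume, NOT a mass gap, NOT Clay; nothing here
claims `hPatch`, (B7), (REC), `hN06`, a stub or the crux.

WHAT IS PROVED (ns `…Prop7Lane2FamilyRowsShape`; data: the package letters `ζ Zc Zs Zb` with the two local rows `hoff`, `hcard` and the (Z2) readings `hZs`, `hZb` of
✓`Prop7Lane2CutoffPackage.exists_cutoffPackage` ∕ ✓`Prop7Lane2CutoffPackageGrid.exists_cutoffPackage_grid`; ANY per-patch data `φ κs : Site → SiteL2K`, `r : Site → BondL2K`;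
ANY letters `ρi Mi Hρi HMi Li Ki Φi : Site (F.P K) 0 → ℝ` dominating the members; ANY real `ν` above the absolute multiplicity constant of FILE 1):
`row_Sr` (`8 ≤ ν`), `row_SM` (`16 ≤ ν`), `row_SHr` (`56 ≤ ν`), `row_SHM` (`392 ≤ ν`), `row_SL` (`56 ≤ ν`), `row_SK` (`8 ≤ ν`), `row_SΦ` (`8 ≤ ν`) — conclusions = tree
`…DivRecoveryPatchesToRows.lean` :84–:90 token for token with `Z := Zs`, `ZE := Zb` and `H` := the local energy `c₀·(L^{K−n})²·CURL_HS + ‖D*_W ·‖²` of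
✓`Prop7Lane2OverlapRows.localEnergy_sum_le_of_overlap` — and ★★★ `family_rows`: the seven as ONE conjunction in `hPatch`'s order for any `ν ≥ 392`, so Patches2 reads
`obtain ⟨hSr, hSM, hSHr, hSHM, hSL, hSK, hSΦ⟩ := family_rows …`.
HONEST SCOPE.  Monotone bookkeeping over FILE 1; nothing of `hPatch`∕(B7)∕(REC)∕hN06∕the crux is proved or claimed.

References: T. Bałaban, CMP 99 (1985) 389–434 [Balaban1985BackgroundPropagators] ((3.11) p.392, (3.19)–(3.26) pp.393–395, (3.100) pp.413–414); CMP 96 (1984) 223–250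
[Balaban1984PropagatorsII] (p.238).
-/

set_option autoImplicit false

noncomputable section

open scoped BigOperators Matrix.Norms.L2Operator Matrix

namespace Summit.QuantumFields.YangMills.Theorems.Prop7Lane2FamilyRowsShape

open Literature.MathematicalPhysics.QuantumFieldTheory.Balaban1983to89
open Literature.MathematicalPhysics.QuantumFieldTheory.Balaban1983to89.T3ContinuumYM3Torus
open B10Eq27TorusAxialLog (unitsField toUField)
open B9Eq39Adjoint (curl)
open B9TorusCalculus (torusT)
open B11Eq103H1Complex (SiteL2K BondL2K)
open Summit.QuantumFields.YangMills.Theorems.Prop7SectET3Transport (periodsT3)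
open Summit.QuantumFields.YangMills.Theorems.Prop7SectET3HilbertLetters (W₂ toL2 toL2S DL2 DstarL2 covLapSite)
open Summit.QuantumFields.YangMills.Theorems.Prop7Lane2FamilyRows (norm_sq_sum_siteCutoff_le norm_sq_sum_bondCutoff_le norm_sq_sum_gradComm_le
  norm_sq_sum_lapComm_le localEnergy_sum_bondCutoff_le localEnergy_sum_gradComm_le)
open Finset

/-! ## §1 The monotone step -/

/-- `T ≤ C·Σ a`, `0 ≤ a ≤ X` termwise and `0 ≤ C ≤ ν` give `T ≤ ν·Σ X`. [folklore] -/
theorem le_mul_sum_of_dominated {ι : Type*} [Fintype ι] (a X : ι → ℝ) {C ν T : ℝ} (hT : T ≤ C * ∑ i, a i)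
    (ha : ∀ i, 0 ≤ a i) (haX : ∀ i, a i ≤ X i) (hC : 0 ≤ C) (hν : C ≤ ν) : T ≤ ν * ∑ i, X i := by
  have hX : 0 ≤ ∑ i, X i := Finset.sum_nonneg fun i _ => (ha i).trans (haX i)
  calc T ≤ C * ∑ i, a i := hT
    _ ≤ C * ∑ i, X i := mul_le_mul_of_nonneg_left (Finset.sum_le_sum fun i _ => haX i) hC
    _ ≤ ν * ∑ i, X i := mul_le_mul_of_nonneg_right hν hX

variable (F : T3Family) (n K : ℕ) (c₀ : ℝ) [Fact (0 < c₀)]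

/-- The local energy `H f := c₀·(L^{K−n})²·CURL_HS(f) + ‖D*_W f‖²` is non-negative. [cite: Balaban1985BackgroundPropagators, (3.4) p.391, (3.8) p.392] -/
theorem localEnergy_nonneg (W : GaugeField (F.P K) 0 (Matrix.specialUnitaryGroup (Fin 2) ℂ)) (f : BondL2K ℂ 3 (periodsT3 F K) c₀ W₂) :
    0 ≤ c₀ * ((F.L : ℝ) ^ (K - n)) ^ 2 * (∑ x : Site (F.P K) 0, ∑ μ : Fin (F.P K).d, ∑ ν' : Fin (F.P K).d,
          (if μ < ν' then ∑ j : Fin 2, ∑ k : Fin 2,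
            ‖(curl (torusT (F.P K) 0) (fun κ z => unitsField (toUField W) ⟨z, κ⟩)
              (fun κ z => (toL2 F K c₀).symm (f) ⟨z, κ⟩) μ ν' x) j k‖ ^ 2 else 0))
        + ‖DstarL2 F n K c₀ W (f)‖ ^ 2 := by
  have hc : 0 < c₀ := Fact.out
  refine add_nonneg (mul_nonneg (by positivity) (Finset.sum_nonneg fun x _ => Finset.sum_nonneg fun μ _ => Finset.sum_nonneg fun ν' _ => ?_)) (sq_nonneg _)
  split_ifs
  · positivity
  · exact le_rfl

/-! ## §2 The seven rows of `hPatch` (:84–:90), free letters, any `ν` above the absolute constant -/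

section Rows

variable {F K}
variable (ζ : Site (F.P K) 0 → Site (F.P K) 0 → ℝ) (Zc : Finset (Site (F.P K) 0))
  (Zs : Site (F.P K) 0 → (SiteL2K ℂ 3 (periodsT3 F K) c₀ W₂ →ₗ[ℂ] SiteL2K ℂ 3 (periodsT3 F K) c₀ W₂))
  (Zb : Site (F.P K) 0 → (BondL2K ℂ 3 (periodsT3 F K) c₀ W₂ →ₗ[ℂ] BondL2K ℂ 3 (periodsT3 F K) c₀ W₂))
  (W : GaugeField (F.P K) 0 (Matrix.specialUnitaryGroup (Fin 2) ℂ))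

/-- ★ Row :84 (`Sr`): `‖Σ_i ZE_i(r_i)‖² ≤ ν·Σ_i ρi i` for any `ρi ≥ ‖ZE_i(r_i)‖²` and `ν ≥ 8`. [cite: Balaban1985BackgroundPropagators, (3.11) p.392, (3.26) p.395] -/
theorem row_Sr (hoff : ∀ c, c ∉ Zc → ∀ x, ζ c x = 0) (hcard : ∀ x, (Zc.filter (fun c => ζ c x ≠ 0)).card ≤ 8)
    (hZb : ∀ c f b, (toL2 F K c₀).symm (Zb c f) b = ζ c b.src • (toL2 F K c₀).symm f b)
    (r : Site (F.P K) 0 → BondL2K ℂ 3 (periodsT3 F K) c₀ W₂) (ρi : Site (F.P K) 0 → ℝ) (hρ : ∀ i, ‖Zb i (r i)‖ ^ 2 ≤ ρi i)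
    {ν : ℝ} (hν : 8 ≤ ν) :
    ‖∑ i, Zb i (r i)‖ ^ 2 ≤ ν * ∑ i, ρi i :=
  le_mul_sum_of_dominated (fun i => ‖Zb i (r i)‖ ^ 2) ρi (norm_sq_sum_bondCutoff_le c₀ ζ Zc Zb hoff hcard hZb r)
    (fun i => sq_nonneg _) hρ (by norm_num) hν

/-- ★★ Row :85 (`SM`): `‖Σ_i (D_W(Z_i φ_i) − ZE_i(D_W φ_i))‖² ≤ ν·Σ_i Mi i` for any `Mi` dominating the members and `ν ≥ 16`.
[cite: Balaban1985BackgroundPropagators, (3.11) p.392, (3.100) pp.413–414] -/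
theorem row_SM (hoff : ∀ c, c ∉ Zc → ∀ x, ζ c x = 0) (hcard : ∀ x, (Zc.filter (fun c => ζ c x ≠ 0)).card ≤ 8)
    (hZs : ∀ c φ x, (toL2S F K c₀).symm (Zs c φ) x = ζ c x • (toL2S F K c₀).symm φ x)
    (hZb : ∀ c f b, (toL2 F K c₀).symm (Zb c f) b = ζ c b.src • (toL2 F K c₀).symm f b)
    (φ : Site (F.P K) 0 → SiteL2K ℂ 3 (periodsT3 F K) c₀ W₂) (Mi : Site (F.P K) 0 → ℝ)
    (hM : ∀ i, ‖DL2 F n K c₀ W (Zs i (φ i)) - Zb i (DL2 F n K c₀ W (φ i))‖ ^ 2 ≤ Mi i) {ν : ℝ} (hν : 16 ≤ ν) :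
    ‖∑ i, (DL2 F n K c₀ W (Zs i (φ i)) - Zb i (DL2 F n K c₀ W (φ i)))‖ ^ 2 ≤ ν * ∑ i, Mi i :=
  le_mul_sum_of_dominated (fun i => ‖DL2 F n K c₀ W (Zs i (φ i)) - Zb i (DL2 F n K c₀ W (φ i))‖ ^ 2) Mi (norm_sq_sum_gradComm_le n c₀ ζ Zc Zs Zb W hoff hcard hZs hZb φ)
    (fun i => sq_nonneg _) hM (by norm_num) hν

/-- ★★ Row :86 (`SHr`): `H(Σ_i ZE_i(r_i)) ≤ ν·Σ_i Hρi i` for any `Hρi ≥ H(ZE_i(r_i))` and `ν ≥ 56`, `H` = the local energy.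
[cite: Balaban1985BackgroundPropagators, (3.4) p.391, (3.8)–(3.11) p.392, (3.100) pp.413–414] -/
theorem row_SHr (hoff : ∀ c, c ∉ Zc → ∀ x, ζ c x = 0) (hcard : ∀ x, (Zc.filter (fun c => ζ c x ≠ 0)).card ≤ 8)
    (hZb : ∀ c f b, (toL2 F K c₀).symm (Zb c f) b = ζ c b.src • (toL2 F K c₀).symm f b)
    (r : Site (F.P K) 0 → BondL2K ℂ 3 (periodsT3 F K) c₀ W₂) (Hρi : Site (F.P K) 0 → ℝ)
    (hH : ∀ i, c₀ * ((F.L : ℝ) ^ (K - n)) ^ 2 * (∑ x : Site (F.P K) 0, ∑ μ : Fin (F.P K).d, ∑ ν' : Fin (F.P K).d,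
          (if μ < ν' then ∑ j : Fin 2, ∑ k : Fin 2,
            ‖(curl (torusT (F.P K) 0) (fun κ z => unitsField (toUField W) ⟨z, κ⟩)
              (fun κ z => (toL2 F K c₀).symm (Zb i (r i)) ⟨z, κ⟩) μ ν' x) j k‖ ^ 2 else 0))
        + ‖DstarL2 F n K c₀ W (Zb i (r i))‖ ^ 2 ≤ Hρi i) {ν : ℝ} (hν : 56 ≤ ν) :
    c₀ * ((F.L : ℝ) ^ (K - n)) ^ 2 * (∑ x : Site (F.P K) 0, ∑ μ : Fin (F.P K).d, ∑ ν' : Fin (F.P K).d,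
          (if μ < ν' then ∑ j : Fin 2, ∑ k : Fin 2,
            ‖(curl (torusT (F.P K) 0) (fun κ z => unitsField (toUField W) ⟨z, κ⟩)
              (fun κ z => (toL2 F K c₀).symm (∑ i, Zb i (r i)) ⟨z, κ⟩) μ ν' x) j k‖ ^ 2 else 0))
        + ‖DstarL2 F n K c₀ W (∑ i, Zb i (r i))‖ ^ 2 ≤ ν * ∑ i, Hρi i :=
  le_mul_sum_of_dominated (fun i => c₀ * ((F.L : ℝ) ^ (K - n)) ^ 2 * (∑ x : Site (F.P K) 0, ∑ μ : Fin (F.P K).d, ∑ ν' : Fin (F.P K).d,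
          (if μ < ν' then ∑ j : Fin 2, ∑ k : Fin 2,
            ‖(curl (torusT (F.P K) 0) (fun κ z => unitsField (toUField W) ⟨z, κ⟩)
              (fun κ z => (toL2 F K c₀).symm (Zb i (r i)) ⟨z, κ⟩) μ ν' x) j k‖ ^ 2 else 0))
        + ‖DstarL2 F n K c₀ W (Zb i (r i))‖ ^ 2) Hρi (localEnergy_sum_bondCutoff_le n c₀ ζ Zc Zb W hoff hcard hZb r)
    (fun i => localEnergy_nonneg F n K c₀ W _) hH (by norm_num) hν

/-- ★★★ Row :87 (`SHM`): `H(Σ_i (D_W(Z_i φ_i) − ZE_i(D_W φ_i))) ≤ ν·Σ_i HMi i` for any `HMi` dominating the members' local energies and `ν ≥ 392`.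
[cite: Balaban1985BackgroundPropagators, (3.3)–(3.4) p.391, (3.8)–(3.11) p.392, (3.100) pp.413–414] -/
theorem row_SHM (hoff : ∀ c, c ∉ Zc → ∀ x, ζ c x = 0) (hcard : ∀ x, (Zc.filter (fun c => ζ c x ≠ 0)).card ≤ 8)
    (hZs : ∀ c φ x, (toL2S F K c₀).symm (Zs c φ) x = ζ c x • (toL2S F K c₀).symm φ x)
    (hZb : ∀ c f b, (toL2 F K c₀).symm (Zb c f) b = ζ c b.src • (toL2 F K c₀).symm f b)
    (φ : Site (F.P K) 0 → SiteL2K ℂ 3 (periodsT3 F K) c₀ W₂) (HMi : Site (F.P K) 0 → ℝ)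
    (hH : ∀ i, c₀ * ((F.L : ℝ) ^ (K - n)) ^ 2 * (∑ x : Site (F.P K) 0, ∑ μ : Fin (F.P K).d, ∑ ν' : Fin (F.P K).d,
          (if μ < ν' then ∑ j : Fin 2, ∑ k : Fin 2,
            ‖(curl (torusT (F.P K) 0) (fun κ z => unitsField (toUField W) ⟨z, κ⟩)
              (fun κ z => (toL2 F K c₀).symm (DL2 F n K c₀ W (Zs i (φ i)) - Zb i (DL2 F n K c₀ W (φ i))) ⟨z, κ⟩) μ ν' x) j k‖ ^ 2 else 0))
        + ‖DstarL2 F n K c₀ W (DL2 F n K c₀ W (Zs i (φ i)) - Zb i (DL2 F n K c₀ W (φ i)))‖ ^ 2 ≤ HMi i) {ν : ℝ} (hν : 392 ≤ ν) :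
    c₀ * ((F.L : ℝ) ^ (K - n)) ^ 2 * (∑ x : Site (F.P K) 0, ∑ μ : Fin (F.P K).d, ∑ ν' : Fin (F.P K).d,
          (if μ < ν' then ∑ j : Fin 2, ∑ k : Fin 2,
            ‖(curl (torusT (F.P K) 0) (fun κ z => unitsField (toUField W) ⟨z, κ⟩)
              (fun κ z => (toL2 F K c₀).symm (∑ i, (DL2 F n K c₀ W (Zs i (φ i)) - Zb i (DL2 F n K c₀ W (φ i)))) ⟨z, κ⟩) μ ν' x) j k‖ ^ 2 else 0))
        + ‖DstarL2 F n K c₀ W (∑ i, (DL2 F n K c₀ W (Zs i (φ i)) - Zb i (DL2 F n K c₀ W (φ i))))‖ ^ 2 ≤ ν * ∑ i, HMi i :=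
  le_mul_sum_of_dominated (fun i => c₀ * ((F.L : ℝ) ^ (K - n)) ^ 2 * (∑ x : Site (F.P K) 0, ∑ μ : Fin (F.P K).d, ∑ ν' : Fin (F.P K).d,
          (if μ < ν' then ∑ j : Fin 2, ∑ k : Fin 2,
            ‖(curl (torusT (F.P K) 0) (fun κ z => unitsField (toUField W) ⟨z, κ⟩)
              (fun κ z => (toL2 F K c₀).symm (DL2 F n K c₀ W (Zs i (φ i)) - Zb i (DL2 F n K c₀ W (φ i))) ⟨z, κ⟩) μ ν' x) j k‖ ^ 2 else 0))
        + ‖DstarL2 F n K c₀ W (DL2 F n K c₀ W (Zs i (φ i)) - Zb i (DL2 F n K c₀ W (φ i)))‖ ^ 2) HMi (localEnergy_sum_gradComm_le n c₀ ζ Zc Zs Zb W hoff hcard hZs hZb φ)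
    (fun i => localEnergy_nonneg F n K c₀ W _) hH (by norm_num) hν

/-- ★★ Row :88 (`SL`): `‖Σ_i (Δ_W(Z_i φ_i) − Z_i(Δ_W φ_i))‖² ≤ ν·Σ_i Li i` for any `Li` dominating the members and `ν ≥ 56`.
[cite: Balaban1985BackgroundPropagators, (3.11) p.392, (3.23) p.394, (3.100) pp.413–414] -/
theorem row_SL (hoff : ∀ c, c ∉ Zc → ∀ x, ζ c x = 0) (hcard : ∀ x, (Zc.filter (fun c => ζ c x ≠ 0)).card ≤ 8)
    (hZs : ∀ c φ x, (toL2S F K c₀).symm (Zs c φ) x = ζ c x • (toL2S F K c₀).symm φ x)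
    (φ : Site (F.P K) 0 → SiteL2K ℂ 3 (periodsT3 F K) c₀ W₂) (Li : Site (F.P K) 0 → ℝ)
    (hL : ∀ i, ‖covLapSite F n K c₀ W (Zs i (φ i)) - Zs i (covLapSite F n K c₀ W (φ i))‖ ^ 2 ≤ Li i) {ν : ℝ} (hν : 56 ≤ ν) :
    ‖∑ i, (covLapSite F n K c₀ W (Zs i (φ i)) - Zs i (covLapSite F n K c₀ W (φ i)))‖ ^ 2 ≤ ν * ∑ i, Li i :=
  le_mul_sum_of_dominated (fun i => ‖covLapSite F n K c₀ W (Zs i (φ i)) - Zs i (covLapSite F n K c₀ W (φ i))‖ ^ 2) Li (norm_sq_sum_lapComm_le n c₀ ζ Zc Zs W hoff hcard hZs φ)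
    (fun i => sq_nonneg _) hL (by norm_num) hν

/-- ★ Row :89 (`SK`): `‖Σ_i Z_i(κs_i)‖² ≤ ν·Σ_i Ki i` for any `Ki ≥ ‖Z_i(κs_i)‖²` and `ν ≥ 8`. [cite: Balaban1985BackgroundPropagators, (3.11) p.392, (3.19) p.393] -/
theorem row_SK (hoff : ∀ c, c ∉ Zc → ∀ x, ζ c x = 0) (hcard : ∀ x, (Zc.filter (fun c => ζ c x ≠ 0)).card ≤ 8)
    (hZs : ∀ c φ x, (toL2S F K c₀).symm (Zs c φ) x = ζ c x • (toL2S F K c₀).symm φ x)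
    (κs : Site (F.P K) 0 → SiteL2K ℂ 3 (periodsT3 F K) c₀ W₂) (Ki : Site (F.P K) 0 → ℝ) (hK : ∀ i, ‖Zs i (κs i)‖ ^ 2 ≤ Ki i)
    {ν : ℝ} (hν : 8 ≤ ν) :
    ‖∑ i, Zs i (κs i)‖ ^ 2 ≤ ν * ∑ i, Ki i :=
  le_mul_sum_of_dominated (fun i => ‖Zs i (κs i)‖ ^ 2) Ki (norm_sq_sum_siteCutoff_le c₀ ζ Zc Zs hoff hcard hZs κs)
    (fun i => sq_nonneg _) hK (by norm_num) hν

/-- ★ Row :90 (`SΦ`): `‖Σ_i Z_i(φ_i)‖² ≤ ν·Σ_i Φi i` for any `Φi ≥ ‖Z_i(φ_i)‖²` and `ν ≥ 8`. [cite: Balaban1985BackgroundPropagators, (3.11) p.392, (3.19) p.393] -/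
theorem row_SΦ (hoff : ∀ c, c ∉ Zc → ∀ x, ζ c x = 0) (hcard : ∀ x, (Zc.filter (fun c => ζ c x ≠ 0)).card ≤ 8)
    (hZs : ∀ c φ x, (toL2S F K c₀).symm (Zs c φ) x = ζ c x • (toL2S F K c₀).symm φ x)
    (φ : Site (F.P K) 0 → SiteL2K ℂ 3 (periodsT3 F K) c₀ W₂) (Φi : Site (F.P K) 0 → ℝ) (hΦ : ∀ i, ‖Zs i (φ i)‖ ^ 2 ≤ Φi i)
    {ν : ℝ} (hν : 8 ≤ ν) :
    ‖∑ i, Zs i (φ i)‖ ^ 2 ≤ ν * ∑ i, Φi i :=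
  le_mul_sum_of_dominated (fun i => ‖Zs i (φ i)‖ ^ 2) Φi (norm_sq_sum_siteCutoff_le c₀ ζ Zc Zs hoff hcard hZs φ)
    (fun i => sq_nonneg _) hΦ (by norm_num) hν

/-- ★★★ **(FAM) THE SEVEN FAMILY ROWS OF `hPatch` AS ONE CONJUNCTION** (tree `…DivRecoveryPatchesToRows.lean` :84–:90 in order, `Z := Zs`, `ZE := Zb`, `H` := the local
energy), for ANY per-patch data `φ κs r`, ANY dominating letters `ρi Mi Hρi HMi Li Ki Φi` and ANY `ν ≥ 392`.
[cite: Balaban1985BackgroundPropagators, (3.11) p.392, (3.19)–(3.26) pp.393–395, (3.100) pp.413–414; Balaban1984PropagatorsII, p.238] -/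
theorem family_rows (hoff : ∀ c, c ∉ Zc → ∀ x, ζ c x = 0) (hcard : ∀ x, (Zc.filter (fun c => ζ c x ≠ 0)).card ≤ 8)
    (hZs : ∀ c φ x, (toL2S F K c₀).symm (Zs c φ) x = ζ c x • (toL2S F K c₀).symm φ x)
    (hZb : ∀ c f b, (toL2 F K c₀).symm (Zb c f) b = ζ c b.src • (toL2 F K c₀).symm f b)
    (φ κs : Site (F.P K) 0 → SiteL2K ℂ 3 (periodsT3 F K) c₀ W₂) (r : Site (F.P K) 0 → BondL2K ℂ 3 (periodsT3 F K) c₀ W₂)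
    (ρi Mi Hρi HMi Li Ki Φi : Site (F.P K) 0 → ℝ)
    (hρ : ∀ i, ‖Zb i (r i)‖ ^ 2 ≤ ρi i) (hM : ∀ i, ‖DL2 F n K c₀ W (Zs i (φ i)) - Zb i (DL2 F n K c₀ W (φ i))‖ ^ 2 ≤ Mi i)
    (hHρ : ∀ i, c₀ * ((F.L : ℝ) ^ (K - n)) ^ 2 * (∑ x : Site (F.P K) 0, ∑ μ : Fin (F.P K).d, ∑ ν' : Fin (F.P K).d,
          (if μ < ν' then ∑ j : Fin 2, ∑ k : Fin 2,
            ‖(curl (torusT (F.P K) 0) (fun κ z => unitsField (toUField W) ⟨z, κ⟩)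
              (fun κ z => (toL2 F K c₀).symm (Zb i (r i)) ⟨z, κ⟩) μ ν' x) j k‖ ^ 2 else 0))
        + ‖DstarL2 F n K c₀ W (Zb i (r i))‖ ^ 2 ≤ Hρi i)
    (hHM : ∀ i, c₀ * ((F.L : ℝ) ^ (K - n)) ^ 2 * (∑ x : Site (F.P K) 0, ∑ μ : Fin (F.P K).d, ∑ ν' : Fin (F.P K).d,
          (if μ < ν' then ∑ j : Fin 2, ∑ k : Fin 2,
            ‖(curl (torusT (F.P K) 0) (fun κ z => unitsField (toUField W) ⟨z, κ⟩)
              (fun κ z => (toL2 F K c₀).symm (DL2 F n K c₀ W (Zs i (φ i)) - Zb i (DL2 F n K c₀ W (φ i))) ⟨z, κ⟩) μ ν' x) j k‖ ^ 2 else 0))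
        + ‖DstarL2 F n K c₀ W (DL2 F n K c₀ W (Zs i (φ i)) - Zb i (DL2 F n K c₀ W (φ i)))‖ ^ 2 ≤ HMi i)
    (hL : ∀ i, ‖covLapSite F n K c₀ W (Zs i (φ i)) - Zs i (covLapSite F n K c₀ W (φ i))‖ ^ 2 ≤ Li i) (hK : ∀ i, ‖Zs i (κs i)‖ ^ 2 ≤ Ki i) (hΦ : ∀ i, ‖Zs i (φ i)‖ ^ 2 ≤ Φi i)
    {ν : ℝ} (hν : 392 ≤ ν) :
    (‖∑ i, Zb i (r i)‖ ^ 2 ≤ ν * ∑ i, ρi i) ∧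
    (‖∑ i, (DL2 F n K c₀ W (Zs i (φ i)) - Zb i (DL2 F n K c₀ W (φ i)))‖ ^ 2 ≤ ν * ∑ i, Mi i) ∧
    (c₀ * ((F.L : ℝ) ^ (K - n)) ^ 2 * (∑ x : Site (F.P K) 0, ∑ μ : Fin (F.P K).d, ∑ ν' : Fin (F.P K).d,
          (if μ < ν' then ∑ j : Fin 2, ∑ k : Fin 2,
            ‖(curl (torusT (F.P K) 0) (fun κ z => unitsField (toUField W) ⟨z, κ⟩)
              (fun κ z => (toL2 F K c₀).symm (∑ i, Zb i (r i)) ⟨z, κ⟩) μ ν' x) j k‖ ^ 2 else 0))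
        + ‖DstarL2 F n K c₀ W (∑ i, Zb i (r i))‖ ^ 2 ≤ ν * ∑ i, Hρi i) ∧
    (c₀ * ((F.L : ℝ) ^ (K - n)) ^ 2 * (∑ x : Site (F.P K) 0, ∑ μ : Fin (F.P K).d, ∑ ν' : Fin (F.P K).d,
          (if μ < ν' then ∑ j : Fin 2, ∑ k : Fin 2,
            ‖(curl (torusT (F.P K) 0) (fun κ z => unitsField (toUField W) ⟨z, κ⟩)
              (fun κ z => (toL2 F K c₀).symm (∑ i, (DL2 F n K c₀ W (Zs i (φ i)) - Zb i (DL2 F n K c₀ W (φ i)))) ⟨z, κ⟩) μ ν' x) j k‖ ^ 2 else 0))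
        + ‖DstarL2 F n K c₀ W (∑ i, (DL2 F n K c₀ W (Zs i (φ i)) - Zb i (DL2 F n K c₀ W (φ i))))‖ ^ 2 ≤ ν * ∑ i, HMi i) ∧
    (‖∑ i, (covLapSite F n K c₀ W (Zs i (φ i)) - Zs i (covLapSite F n K c₀ W (φ i)))‖ ^ 2 ≤ ν * ∑ i, Li i) ∧
    (‖∑ i, Zs i (κs i)‖ ^ 2 ≤ ν * ∑ i, Ki i) ∧
    (‖∑ i, Zs i (φ i)‖ ^ 2 ≤ ν * ∑ i, Φi i) :=
  ⟨row_Sr c₀ ζ Zc Zb hoff hcard hZb r ρi hρ (by linarith),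
   row_SM n c₀ ζ Zc Zs Zb W hoff hcard hZs hZb φ Mi hM (by linarith),
   row_SHr n c₀ ζ Zc Zb W hoff hcard hZb r Hρi hHρ (by linarith),
   row_SHM n c₀ ζ Zc Zs Zb W hoff hcard hZs hZb φ HMi hHM hν,
   row_SL n c₀ ζ Zc Zs W hoff hcard hZs φ Li hL (by linarith),
   row_SK c₀ ζ Zc Zs hoff hcard hZs κs Ki hK (by linarith),
   row_SΦ c₀ ζ Zc Zs hoff hcard hZs φ Φi hΦ (by linarith)⟩

end Rows

end Summit.QuantumFields.YangMills.Theorems.Prop7Lane2FamilyRowsShape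

end
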